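import Summits.BirchSwinnertonDyer.BirchSwinnertonDyer.Theorems.DefiniteThetaDerivedHeightCapIwasawaSerreCertificate
import Summits.BirchSwinnertonDyer.BirchSwinnertonDyer.Theorems.DefiniteThetaDerivedHeightCapBirthNormCompatible
import Summits.BirchSwinnertonDyer.BirchSwinnertonDyer.Theses.DefiniteTheta
import HarnessLib

/-!
# At an admissible definite datum the crux `DerivedHeightCap` reads `corank Sel_{p^∞}(V/ℚ) ≤ ord_X L_f`, and is EQUIVALENT to its stub `stub_lpCap`

Route-independent `Theorems` file (cell `b2b-bsdres`, seat `b2b-bsdres-x10b`, gen 46), part 23 of the series «tower square root»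
serving crux `DerivedHeightCap` (stmt-BirchSwinnertonDyer-18438, route DefiniteTheta, line «birth»).
HONEST FRAMING: no curve asserted, no class closed, BSD not proved by any of this; `DerivedHeightCap` is NOT proved here — it is
REFORMULATED (its conclusion becomes an inequality on the `X`-adic order of one power series) and shown equivalent to the line's
remaining stub.

For an ADMISSIBLE DEFINITE DATUM `(V, p, N⁺, N⁻, K, S, T, φ)` (the crux's hypothesis block, verbatim) the theta elements are
norm-compatible at the unit root `α_p` (gen 43, `stub_normCompatible`, p747225) and `K` is imaginary quadratic, so parts 19–22 apply:

* §1 ★ `exists_powerSeries_of_admissible` — there is `L ∈ ℤ_p⟦X⟧` with `T.acOrderOfVanishing p φ α_p = ord_X L`,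
  `T.VanishesToOrderAc … ρ ↔ X^ρ ∣ L`, `T.HasMuZeroAc … ↔ p ∤ L`, `θ_n^{ac} ι(θ_n^{ac}) ∈ I^ρ ∀ n ↔ ρ ≤ 2 ord_X L`;
* §2 ★★ `derivedHeightCap_iff_lpCap` — **`Theses.DefiniteTheta.DerivedHeightCap ↔` the registered signature of `stub_lpCap`** (both say
  `s ≤ ord_X L_f`, `s = V.selmerCorank p`, at every admissible datum): the skeleton `Lines/birth.lean` composes an EQUIVALENCE, so the crux is
  exactly as hard as its last stub (see the evidence memo `ev18438-lpcap-print.md` for what print gives: the stub exceeds CH15 + control by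
  BD95's Tamagawa hypothesis);
* §3 `acOrderOfVanishing_lt_top_of_admissible_of_vatsal` — CONDITIONAL on the named fact `vatsal_hasMuZeroAc` (Vatsal 2003 / PW11 Thm 2.3,
  typed for square-free `N`): at an admissible datum with `N⁺N⁻` square-free, `ord_J θ^{ac}(V, K, p) < ⊤`.

## References
* [BertoliniDarmon2005] §1.2 (18)–(21), Cor. 3; [BertoliniDarmon1996] Prop. 2.7, §2.12, Conj. 4.1; [PollackWeston2011] Thm. 2.3; [Vatsal2003] Thm. 1.1.
-/

noncomputable section

open scoped BigOperators Polynomial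

-- D-0017: single-problem summit, the namespace repeats the problem name by design.
set_option linter.dupNamespace false

namespace Summit.BirchSwinnertonDyer.BirchSwinnertonDyer.Theorems.TowerSqrt

open Literature.NumberTheory.EllipticCurves Literature.NumberTheory.EllipticCurves.QuadOrderTower NumberField
  Literature.NumberTheory.Automorphic Module
open Summit.BirchSwinnertonDyer.BirchSwinnertonDyer.Theorems.DerivedHeightCapNormCompatible (stub_normCompatible)

/-! ### §1 The power series of an admissible datum -/

/-- `2s ≤ o + o ↔ s ≤ o` in `ℕ∞`. [folklore] -/
theorem two_mul_le_add_self_iff (s : ℕ) (o : ℕ∞) : ((2 * s : ℕ) : ℕ∞) ≤ o + o ↔ (s : ℕ∞) ≤ o := by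
  induction o using ENat.recTopCoe with
  | top => simp
  | coe m =>
    norm_cast
    omega

-- see part 8: statements over the quotients `AcLayerGroup` need a little more than the default instance budget in this import closure
set_option synthInstance.maxHeartbeats 40000 in
/-- ★ **The Iwasawa power series of an admissible definite datum**: for `(V, p, N⁺, N⁻, K, S, T, φ)` satisfying the hypothesis block of
`DerivedHeightCap` there is `L ∈ ℤ_p⟦X⟧` with `T.acOrderOfVanishing p φ α_p = ord_X L`, `T.VanishesToOrderAc p φ α_p ρ ↔ X^ρ ∣ L`,
`T.HasMuZeroAc p φ α_p ↔ p ∤ L` and `θ_n^{ac} ι(θ_n^{ac}) ∈ I^ρ ∀ n ↔ ρ ≤ 2 ord_X L` (`α_p = padicUnitRoot p (a_p)`): the block gives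
`K` imaginary quadratic and (gen 43) norm-compatibility, and part 19 applies. [cite: BertoliniDarmon2005, §1.2 (18)–(21) and Cor. 3] -/
theorem exists_powerSeries_of_admissible :
    ∀ (V : WeierstrassCurve ℚ) [V.IsElliptic] [V.IsGloballyMinimal] (p : ℕ) [Fact p.Prime] (Nplus Nminus : ℕ) (K : Type) [Field K]
      [NumberField K] (S : Brandt.XiSetup Nplus Nminus) [Fintype (Brandt.ClassSet S.O)] (T : GrossPointTower K S p)
      (φ : Brandt.ClassSet S.O → ℤ),
      ((7 ≤ p ∧ V.HasGoodReductionAtPrime p ∧ ¬ (p : ℤ) ∣ V.frobeniusTrace p ∧ ¬ (p : ℤ) ∣ (V.frobeniusTrace p) ^ 2 - 1 ∧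
          V.HasSurjectiveModNGaloisRep p ∧ (∀ q : ℕ, q.Prime → q ∣ V.conductorNorm ℤ → ¬ (p : ℤ) ∣ (q : ℤ) ^ 2 - 1) ∧
          ¬ p ∣ NumberField.classNumber K) ∧
        (Module.finrank ℚ K = 2 ∧ NumberField.IsTotallyComplex K ∧ NumberField.discr K < -4 ∧
          Int.gcd (NumberField.discr K) (V.conductorNorm ℤ * p) = 1) ∧
        (V.conductorNorm ℤ = Nplus * Nminus ∧ Nat.Coprime Nplus Nminus ∧ Odd Nminus.primeFactors.card ∧
          (∀ q : ℕ, q.Prime → q ∣ Nplus → ((Ideal.span {(q : ℤ)}).primesOver (NumberField.RingOfIntegers K)).ncard = 2) ∧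
          (∀ q : ℕ, q.Prime → q ∣ Nminus → ((Ideal.span {(q : ℤ)}).primesOver (NumberField.RingOfIntegers K)).ncard = 1)) ∧
        (φ ≠ 0 ∧ Brandt.eigenLattice (Nplus * Nminus) (Brandt.matrix S.O) (fun n => V.LFunction n) = Submodule.span ℤ {φ})) →
      ∃ L : PowerSeries ℤ_[p],
        T.acOrderOfVanishing p φ (padicUnitRoot p (V.LFunction p)) = L.order ∧
        (∀ ρ : ℕ, T.VanishesToOrderAc p φ (padicUnitRoot p (V.LFunction p)) ρ ↔ (PowerSeries.X : PowerSeries ℤ_[p]) ^ ρ ∣ L) ∧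
        (T.HasMuZeroAc p φ (padicUnitRoot p (V.LFunction p)) ↔ ¬ (PowerSeries.C (p : ℤ_[p]) : PowerSeries ℤ_[p]) ∣ L) ∧
        (∀ ρ : ℕ, (∀ n : ℕ, T.thetaAc p φ (padicUnitRoot p (V.LFunction p)) n *
            MonoidAlgebra.mapDomain (fun σ => σ⁻¹) (T.thetaAc p φ (padicUnitRoot p (V.LFunction p)) n) ∈
              augIdeal ℤ_[p] (AcLayerGroup K p (n + 1)) ^ ρ) ↔ (ρ : ℕ∞) ≤ L.order + L.order) := by
  intro V _ _ p _ Nplus Nminus K _ _ S _ T φ h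
  have hnc := stub_normCompatible V p Nplus Nminus K S T φ h
  obtain ⟨-, ⟨h2, htc, -, -⟩, -, -⟩ := h
  exact exists_powerSeries_acOrderOfVanishing_eq_order p φ _ T ⟨h2, htc⟩ hnc

/-! ### §2 The crux is equivalent to its last stub -/

-- see part 8
set_option synthInstance.maxHeartbeats 40000 in
/-- ★★ **`DerivedHeightCap ↔ stub_lpCap` (registered signatures).** At every admissible datum both say `s ≤ ord_X L_f`
(`s = corank_{ℤ_p} Sel_{p^∞}(V/ℚ)`): the crux's `(s : ℕ∞) ≤ T.acOrderOfVanishing …` is `s ≤ ord_X L_f` (§1), and the stub's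
`θ_n^{ac} ι(θ_n^{ac}) ∈ I^{2s} ∀ n` is `2s ≤ 2 ord_X L_f` (§1, part 18 §4). So the line «birth» decomposes the crux into two proved stubs and
one stub EQUIVALENT to the crux. [cite: BertoliniDarmon2005, §1.2 (18)–(21) and Cor. 3] [cite: BertoliniDarmon1996, §2.12 and Conj. 4.1] -/
theorem derivedHeightCap_iff_lpCap :
    Summit.BirchSwinnertonDyer.BirchSwinnertonDyer.Theses.DefiniteTheta.DerivedHeightCap ↔
      ∀ (V : WeierstrassCurve ℚ) [V.IsElliptic] [V.IsGloballyMinimal] (p : ℕ) [Fact p.Prime] (Nplus Nminus : ℕ) (K : Type) [Field K]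
        [NumberField K] (S : Literature.NumberTheory.Automorphic.Brandt.XiSetup Nplus Nminus)
        [Fintype (Literature.NumberTheory.Automorphic.Brandt.ClassSet S.O)] (T : Literature.NumberTheory.EllipticCurves.GrossPointTower K S p)
        (φ : Literature.NumberTheory.Automorphic.Brandt.ClassSet S.O → ℤ),
        ((7 ≤ p ∧ V.HasGoodReductionAtPrime p ∧ ¬ (p : ℤ) ∣ V.frobeniusTrace p ∧ ¬ (p : ℤ) ∣ (V.frobeniusTrace p) ^ 2 - 1 ∧
            V.HasSurjectiveModNGaloisRep p ∧ (∀ q : ℕ, q.Prime → q ∣ V.conductorNorm ℤ → ¬ (p : ℤ) ∣ (q : ℤ) ^ 2 - 1) ∧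
            ¬ p ∣ NumberField.classNumber K) ∧
          (Module.finrank ℚ K = 2 ∧ NumberField.IsTotallyComplex K ∧ NumberField.discr K < -4 ∧
            Int.gcd (NumberField.discr K) (V.conductorNorm ℤ * p) = 1) ∧
          (V.conductorNorm ℤ = Nplus * Nminus ∧ Nat.Coprime Nplus Nminus ∧ Odd Nminus.primeFactors.card ∧
            (∀ q : ℕ, q.Prime → q ∣ Nplus → ((Ideal.span {(q : ℤ)}).primesOver (NumberField.RingOfIntegers K)).ncard = 2) ∧
            (∀ q : ℕ, q.Prime → q ∣ Nminus → ((Ideal.span {(q : ℤ)}).primesOver (NumberField.RingOfIntegers K)).ncard = 1)) ∧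
          (φ ≠ 0 ∧ Literature.NumberTheory.Automorphic.Brandt.eigenLattice (Nplus * Nminus)
            (Literature.NumberTheory.Automorphic.Brandt.matrix S.O) (fun n => V.LFunction n) = Submodule.span ℤ {φ})) →
        ∀ n : ℕ, T.thetaAc p φ (Literature.NumberTheory.EllipticCurves.padicUnitRoot p (V.LFunction p)) n *
            MonoidAlgebra.mapDomain (fun σ => σ⁻¹)
              (T.thetaAc p φ (Literature.NumberTheory.EllipticCurves.padicUnitRoot p (V.LFunction p)) n) ∈
          Literature.NumberTheory.EllipticCurves.augIdeal ℤ_[p] (Literature.NumberTheory.EllipticCurves.AcLayerGroup K p (n + 1)) ^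
            (2 * V.selmerCorank p) := by
  unfold Summit.BirchSwinnertonDyer.BirchSwinnertonDyer.Theses.DefiniteTheta.DerivedHeightCap
  constructor
  · intro hcap V _ _ p _ Nplus Nminus K _ _ S _ T φ h
    obtain ⟨L, hord, -, -, hprod⟩ := exists_powerSeries_of_admissible V p Nplus Nminus K S T φ h
    have h1 := hcap V p Nplus Nminus K S T φ h
    rw [hord] at h1
    exact (hprod (2 * V.selmerCorank p)).mpr ((two_mul_le_add_self_iff _ _).mpr h1)
  · intro hlp V _ _ p _ Nplus Nminus K _ _ S _ T φ h
    obtain ⟨L, hord, -, -, hprod⟩ := exists_powerSeries_of_admissible V p Nplus Nminus K S T φ h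
    have h1 := (hprod (2 * V.selmerCorank p)).mp (hlp V p Nplus Nminus K S T φ h)
    rw [hord]
    exact (two_mul_le_add_self_iff _ _).mp h1

/-! ### §3 Conditional on Vatsal's `μ = 0`: the order of vanishing at an admissible datum is finite -/

-- see part 8
set_option synthInstance.maxHeartbeats 40000 in
/-- **Conditional on the named fact `vatsal_hasMuZeroAc`** (Vatsal 2003 Thm 1.1 / Pollack–Weston 2011 Thm 2.3 (1), typed in the tree
for square-free `N`): at an admissible definite datum with `N⁺N⁻` square-free the anticyclotomic order of vanishing of `θ(V, K, p)` is
finite (part 21: `μ = 0 ⇒ ord_J θ^{ac} ≤ λ(L_f) < ⊤`). The block supplies Vatsal's hypotheses: `p` odd, `p ∤ N_V d_K`, `N⁺` split, `N⁻`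
inert, `p ∤ a_p`, `ρ̄_{V,p}` irreducible (from surjective), `φ` a generator of the eigen-line. [cite: PollackWeston2011, Thm. 2.3] [cite: Vatsal2003, Thm. 1.1] -/
theorem acOrderOfVanishing_lt_top_of_admissible_of_vatsal :
    ∀ (V : WeierstrassCurve ℚ) [V.IsElliptic] [V.IsGloballyMinimal] (p : ℕ) [Fact p.Prime] (Nplus Nminus : ℕ) (K : Type) [Field K]
      [NumberField K] (S : Brandt.XiSetup Nplus Nminus) [Fintype (Brandt.ClassSet S.O)] (T : GrossPointTower K S p)
      (φ : Brandt.ClassSet S.O → ℤ),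
      vatsal_hasMuZeroAc K S p V → Squarefree (Nplus * Nminus) →
      ((7 ≤ p ∧ V.HasGoodReductionAtPrime p ∧ ¬ (p : ℤ) ∣ V.frobeniusTrace p ∧ ¬ (p : ℤ) ∣ (V.frobeniusTrace p) ^ 2 - 1 ∧
          V.HasSurjectiveModNGaloisRep p ∧ (∀ q : ℕ, q.Prime → q ∣ V.conductorNorm ℤ → ¬ (p : ℤ) ∣ (q : ℤ) ^ 2 - 1) ∧
          ¬ p ∣ NumberField.classNumber K) ∧
        (Module.finrank ℚ K = 2 ∧ NumberField.IsTotallyComplex K ∧ NumberField.discr K < -4 ∧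
          Int.gcd (NumberField.discr K) (V.conductorNorm ℤ * p) = 1) ∧
        (V.conductorNorm ℤ = Nplus * Nminus ∧ Nat.Coprime Nplus Nminus ∧ Odd Nminus.primeFactors.card ∧
          (∀ q : ℕ, q.Prime → q ∣ Nplus → ((Ideal.span {(q : ℤ)}).primesOver (NumberField.RingOfIntegers K)).ncard = 2) ∧
          (∀ q : ℕ, q.Prime → q ∣ Nminus → ((Ideal.span {(q : ℤ)}).primesOver (NumberField.RingOfIntegers K)).ncard = 1)) ∧
        (φ ≠ 0 ∧ Brandt.eigenLattice (Nplus * Nminus) (Brandt.matrix S.O) (fun n => V.LFunction n) = Submodule.span ℤ {φ})) →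
      T.acOrderOfVanishing p φ (padicUnitRoot p (V.LFunction p)) < ⊤ := by
  intro V _ _ p _ Nplus Nminus K _ _ S _ T φ hV hsqf h
  have hnc := stub_normCompatible V p Nplus Nminus K S T φ h
  obtain ⟨⟨h7, hgood, hap, -, hsurj, -, -⟩, ⟨h2, htc, -, hgcd⟩, ⟨hN, -, -, hsplit, hinert⟩, ⟨hφ0, hφ⟩⟩ := h
  have hK : IsImaginaryQuadratic K := ⟨h2, htc⟩
  have hp2 : p ≠ 2 := by omega
  have hpN : ¬ p ∣ Nplus * Nminus := by
    rw [← hN]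
    exact not_dvd_conductorNorm_of_hasGoodReductionAtPrime V hgood
  have hap' : ¬ (p : ℤ) ∣ V.LFunction p := by
    rw [WeierstrassCurve.LFunction_apply_prime_eq_frobeniusTrace V p hgood]
    exact hap
  -- `(N p, d_K) = 1` as a coprimality of naturals
  have hcop : (Nplus * Nminus * p).Coprime (NumberField.discr K).natAbs := by
    have h1 : Int.gcd (V.conductorNorm ℤ * p) (NumberField.discr K) = 1 := by rw [Int.gcd_comm]; exact hgcd
    rw [hN, Int.gcd_eq_natAbs] at h1
    have h2 : (((Nplus * Nminus : ℕ) : ℤ) * (p : ℤ)).natAbs = Nplus * Nminus * p := by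
      rw [Int.natAbs_mul, Int.natAbs_natCast, Int.natAbs_natCast]
    rw [h2] at h1
    exact h1
  have hirr : V.HasIrreducibleModPGaloisRep p := hasIrreducibleModPGaloisRep_of_hasSurjectiveModNGaloisRep V p hsurj
  have hmu : T.HasMuZeroAc p φ (padicUnitRoot p (V.LFunction p)) :=
    hV hK hp2 hN.symm hsqf hcop hpN hsplit hinert hap' hirr φ hφ0 hφ T
  exact acOrderOfVanishing_lt_top_of_hasMuZeroAc K p Nplus Nminus S T φ _ hnc hmu

end Summit.BirchSwinnertonDyer.BirchSwinnertonDyer.Theorems.TowerSqrt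

end
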